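import Mathlib
import Summits.ResolutionOfSingularities.ResolutionOfSingularities.Theorems.WeightedInvariantLocalWeightedDropTOT2NearPlane
import Summits.ResolutionOfSingularities.ResolutionOfSingularities.Theorems.WeightedInvariantLocalWeightedDropNCResCurveGraphStep

/-!
# `WeightedInvariant.LocalWeightedDrop`, TOT₂ line / line `directrix-cut`: (N2) AT APEX DIMENSION TWO ON DECORATED STATES — `e^O ≤ 2` PERSISTS
# AT A SAME-HEAD ANSWER OF THE POINT MOVE (the `htwo` binder of `ApexPlaneExit` propagated along the point move)

Crux item stmt-ResolutionOfSingularities-8899 `LocalWeightedDrop` (route `ResolutionOfSingularities/WeightedInvariant`), ENGINE skeleton v32/v33, residuals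
`stub_spaceNCRankDrop` / `stub_wildWideApexFourStartsWon` (res-L1-w43-strat-1's line `directrix-cut` v3.1, piece PL = `ApexPlaneExit`; S-E2-SURF design memo
`L/res-L1-w43-stub-4/g5/S-E2-SURF.md`).  [OURS · L1 W4.3 · chain w43 · seat res-L1-w43-stub-4 gen 5; def-free; the TRIPLES twins of res-L1-w43-stub-3's
`TOT2Near.Decoration.apexLineO_transform` (S-NEAR part 7) and res-L1-w43-stub-1's `GraphCurve.apexLine_transform_of_head_eq` (S-SET 16), for the POINT
move; on `TOT2Near.apexPlaneRel_of_near` (…TOT2NearPlane).  Nothing here is a statement of any manuscript; AI-produced, gate-checked, weaker than expert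
review.]

* **`TOT2Near.Decoration.apexPlaneO_transform_point`** — (N2) WITH HISTORY ON DECORATED STATES at `e^O ≤ 2`, for a B-permissible move with all weights
  `1` (a point move in any legal coordinates `Φ`): if every three vectors of `Dir^O(in (f∘Φ))` are dependent and at the answer `(c, i)` neither the order
  nor the number of old components dropped, then every three vectors of `Dir^{O′}(in f′)` of the transform are dependent.  (The pairs version derives
  «the centre is the point» from `e ≤ 1`; at `e = 2` a curve centre can have near points, so the point move is assumed.)
* **`TameFourTupleDrop.apexPlane_transform_of_head_eq`** — the same in the currency of the line: from an admissibly decorated `(b, δ)` whose product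
  `g = f·∏_O x_l` has apex dimension `≤ 2` (`htwo`), at an answer of the IDENTITY point move where the head did not drop, the successor's product has
  apex dimension `≤ 2`.
-/

set_option linter.dupNamespace false -- mandated namespace of this single-conjunct summit
set_option autoImplicit false

noncomputable section

namespace Summit.ResolutionOfSingularities.ResolutionOfSingularities.Theorems

open Literature.AlgebraicGeometry.Resolution

namespace TOT2Near

open MvPowerSeries TameFourTupleDrop

variable {k : Type} [Field k] {m : ℕ}
variable {δ : Decoration k m} {Φ : Fin (m + 1) → MvPowerSeries (Fin (m + 1)) k} {c : Fin (m + 1) → k} {i : Fin (m + 1)}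

open Classical in
/-- **(N2) WITH HISTORY ON DECORATED STATES — `e^O ≤ 2` PERSISTS AT A SAME-HEAD ANSWER OF A POINT MOVE**: for a B-permissible move `(Φ, 𝟙)` (all
weights `1`), if every three vectors of `Dir^O(in (f∘Φ))` (invariance vectors of the degree-`o` form vanishing on the old letters `strIdx Φ l`, `l ∈ O`)
are dependent, and at the answer `(c, i)` neither the order nor the number of old components dropped, then every three vectors of `Dir^{O′}(in f′)` of the
transform are dependent. -/
theorem Decoration.apexPlaneO_transform_point (hperm : IsBPermissible δ Φ (fun _ : Fin (m + 1) => 1)) (hf : δ.f ≠ 0) (hci : c i ≠ 0)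
    (htwoO : ∀ u₁ u₂ u₃ : Fin (m + 1) → k,
      (∀ v, CobordantChart.initEval (fun _ : Fin (m + 1) => 1) (v + u₁) δ.o (subst Φ δ.f) =
        CobordantChart.initEval (fun _ : Fin (m + 1) => 1) v δ.o (subst Φ δ.f)) →
      (∀ l ∈ δ.O, u₁ (strIdx Φ l) = 0) →
      (∀ v, CobordantChart.initEval (fun _ : Fin (m + 1) => 1) (v + u₂) δ.o (subst Φ δ.f) =
        CobordantChart.initEval (fun _ : Fin (m + 1) => 1) v δ.o (subst Φ δ.f)) →
      (∀ l ∈ δ.O, u₂ (strIdx Φ l) = 0) →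
      (∀ v, CobordantChart.initEval (fun _ : Fin (m + 1) => 1) (v + u₃) δ.o (subst Φ δ.f) =
        CobordantChart.initEval (fun _ : Fin (m + 1) => 1) v δ.o (subst Φ δ.f)) →
      (∀ l ∈ δ.O, u₃ (strIdx Φ l) = 0) →
      ∃ α β γ : k, (α ≠ 0 ∨ β ≠ 0 ∨ γ ≠ 0) ∧ α • u₁ + β • u₂ + γ • u₃ = 0)
    (heq : (δ.transform Φ (fun _ => 1) c i).o = δ.o) (hcard : (δ.transform Φ (fun _ => 1) c i).O.card = δ.O.card)
    (w₁ w₂ w₃ : Fin (m + 1) → k)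
    (hw₁ : ∀ v, CobordantChart.initEval (fun _ : Fin (m + 1) => 1) (v + w₁) (δ.transform Φ (fun _ => 1) c i).o (δ.transform Φ (fun _ => 1) c i).f =
      CobordantChart.initEval (fun _ : Fin (m + 1) => 1) v (δ.transform Φ (fun _ => 1) c i).o (δ.transform Φ (fun _ => 1) c i).f)
    (hw₁O : ∀ l' ∈ (δ.transform Φ (fun _ => 1) c i).O, w₁ l' = 0)
    (hw₂ : ∀ v, CobordantChart.initEval (fun _ : Fin (m + 1) => 1) (v + w₂) (δ.transform Φ (fun _ => 1) c i).o (δ.transform Φ (fun _ => 1) c i).f =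
      CobordantChart.initEval (fun _ : Fin (m + 1) => 1) v (δ.transform Φ (fun _ => 1) c i).o (δ.transform Φ (fun _ => 1) c i).f)
    (hw₂O : ∀ l' ∈ (δ.transform Φ (fun _ => 1) c i).O, w₂ l' = 0)
    (hw₃ : ∀ v, CobordantChart.initEval (fun _ : Fin (m + 1) => 1) (v + w₃) (δ.transform Φ (fun _ => 1) c i).o (δ.transform Φ (fun _ => 1) c i).f =
      CobordantChart.initEval (fun _ : Fin (m + 1) => 1) v (δ.transform Φ (fun _ => 1) c i).o (δ.transform Φ (fun _ => 1) c i).f)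
    (hw₃O : ∀ l' ∈ (δ.transform Φ (fun _ => 1) c i).O, w₃ l' = 0) :
    ∃ α β γ : k, (α ≠ 0 ∨ β ≠ 0 ∨ γ ≠ 0) ∧ α • w₁ + β • w₂ + γ • w₃ = 0 := by
  have hc0 : ∀ l, (fun _ : Fin (m + 1) => (1 : ℕ)) l = 0 → c l = 0 := fun _ h => absurd h one_ne_zero
  have hnlt : ¬ ((sqfRep (δ.strict Φ (fun _ => 1) c i)).order).toNat < δ.o := by
    rw [← Decoration.transform_o]
    exact fun h => absurd heq (ne_of_lt h)
  have hthrough := Decoration.through_of_card_O_eq hnlt hcard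
  obtain ⟨hfac, -, hnear⟩ := Decoration.nearData_of_o_transform_eq hperm hc0 hf hci heq
  -- the marked letters of the move's coordinates
  set S : Finset (Fin (m + 1)) := δ.O.image (strIdx Φ) with hS
  have hcS : ∀ l' ∈ S, c l' = 0 := by
    rw [hS, Finset.forall_mem_image]
    exact hthrough
  have htwoS : ∀ u₁ u₂ u₃ : Fin (m + 1) → k,
      (∀ v, CobordantChart.initEval (fun _ : Fin (m + 1) => 1) (v + u₁) δ.o (subst Φ δ.f) =
        CobordantChart.initEval (fun _ : Fin (m + 1) => 1) v δ.o (subst Φ δ.f)) →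
      (∀ l' ∈ S, u₁ l' = 0) →
      (∀ v, CobordantChart.initEval (fun _ : Fin (m + 1) => 1) (v + u₂) δ.o (subst Φ δ.f) =
        CobordantChart.initEval (fun _ : Fin (m + 1) => 1) v δ.o (subst Φ δ.f)) →
      (∀ l' ∈ S, u₂ l' = 0) →
      (∀ v, CobordantChart.initEval (fun _ : Fin (m + 1) => 1) (v + u₃) δ.o (subst Φ δ.f) =
        CobordantChart.initEval (fun _ : Fin (m + 1) => 1) v δ.o (subst Φ δ.f)) →
      (∀ l' ∈ S, u₃ l' = 0) →
      ∃ α β γ : k, (α ≠ 0 ∨ β ≠ 0 ∨ γ ≠ 0) ∧ α • u₁ + β • u₂ + γ • u₃ = 0 := by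
    intro u₁ u₂ u₃ h₁ h₁S h₂ h₂S h₃ h₃S
    rw [hS, Finset.forall_mem_image] at h₁S h₂S h₃S
    exact htwoO u₁ u₂ u₃ h₁ h₁S h₂ h₂S h₃ h₃S
  -- the new marked letters
  have hnew : ∀ {u : Fin (m + 1) → k}, (∀ l' ∈ (δ.transform Φ (fun _ => 1) c i).O, u l' = 0) →
      ∀ l' ∈ S, u (Fin.predAbove i l'.succ) = 0 := by
    intro u hu
    rw [hS, Finset.forall_mem_image]
    intro l hl
    refine hu _ ?_
    rw [Decoration.transform_O_of_not_lt _ _ _ _ _ hnlt]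
    unfold Decoration.newLetters
    exact Finset.mem_image.mpr ⟨l, Finset.mem_filter.mpr ⟨hl, hthrough l hl⟩, rfl⟩
  have hw₁S := hnew hw₁O
  have hw₂S := hnew hw₂O
  have hw₃S := hnew hw₃O
  rw [heq, Decoration.transform_f_eq_strict_of_o_transform_eq hperm hc0 hf hci heq] at hw₁ hw₂ hw₃
  exact apexPlaneRel_of_near (subst Φ δ.f) c i hci hfac hnear S hcS htwoS w₁ w₂ w₃ hw₁ hw₁S hw₂ hw₂S hw₃ hw₃S

end TOT2Near

namespace TameFourTupleDrop

open MvPowerSeries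

variable {k : Type} [Field k] {m : ℕ}

/-- **APEX DIMENSION ≤ 2 OF THE PRODUCT PERSISTS AT A SAME-HEAD ANSWER OF THE IDENTITY POINT MOVE** (OURS · L1 W4.3; the `htwo` binder of
`ApexPlaneExit` / S-E2-SURF propagated; triples twin of res-L1-w43-stub-1's `GraphCurve.apexLine_transform_of_head_eq`): from an admissibly decorated
`(b, δ)` whose product `g = f·∏_O x_l` has every three invariance vectors of `in_c g` dependent, at an answer `(c′, i′)` of the identity point move with
unchanged head and an admissibly decorated successor, every three invariance vectors of the successor's product form are dependent. -/
theorem apexPlane_transform_of_head_eq [Infinite k] {b : MvPowerSeries (Fin (m + 1)) k} {δ : Decoration k m} (hadm : Admissible b δ)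
    (htwo : ∀ u₁ u₂ u₃ : Fin (m + 1) → k,
      (∀ v, CobordantChart.initEval (fun _ : Fin (m + 1) => 1) (v + u₁) δ.c (δ.f * ∏ l ∈ δ.O, X l) =
        CobordantChart.initEval (fun _ : Fin (m + 1) => 1) v δ.c (δ.f * ∏ l ∈ δ.O, X l)) →
      (∀ v, CobordantChart.initEval (fun _ : Fin (m + 1) => 1) (v + u₂) δ.c (δ.f * ∏ l ∈ δ.O, X l) =
        CobordantChart.initEval (fun _ : Fin (m + 1) => 1) v δ.c (δ.f * ∏ l ∈ δ.O, X l)) →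
      (∀ v, CobordantChart.initEval (fun _ : Fin (m + 1) => 1) (v + u₃) δ.c (δ.f * ∏ l ∈ δ.O, X l) =
        CobordantChart.initEval (fun _ : Fin (m + 1) => 1) v δ.c (δ.f * ∏ l ∈ δ.O, X l)) →
      ∃ α β γ : k, (α ≠ 0 ∨ β ≠ 0 ∨ γ ≠ 0) ∧ α • u₁ + β • u₂ + γ • u₃ = 0)
    {c' : Fin (m + 1) → k} {i' : Fin (m + 1)} (hci' : c' i' ≠ 0)
    (hhead : (δ.transform (fun j => (X j : MvPowerSeries (Fin (m + 1)) k)) (fun _ => 1) c' i').head = δ.head)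
    {b' : MvPowerSeries (Fin (m + 1)) k} (hadm' : Admissible b' (δ.transform (fun j => (X j : MvPowerSeries (Fin (m + 1)) k)) (fun _ => 1) c' i')) :
    ∀ u₁ u₂ u₃ : Fin (m + 1) → k,
      (∀ v, CobordantChart.initEval (fun _ : Fin (m + 1) => 1) (v + u₁)
          (δ.transform (fun j => (X j : MvPowerSeries (Fin (m + 1)) k)) (fun _ => 1) c' i').c
          ((δ.transform (fun j => (X j : MvPowerSeries (Fin (m + 1)) k)) (fun _ => 1) c' i').f *
            ∏ l ∈ (δ.transform (fun j => (X j : MvPowerSeries (Fin (m + 1)) k)) (fun _ => 1) c' i').O, X l) =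
        CobordantChart.initEval (fun _ : Fin (m + 1) => 1) v
          (δ.transform (fun j => (X j : MvPowerSeries (Fin (m + 1)) k)) (fun _ => 1) c' i').c
          ((δ.transform (fun j => (X j : MvPowerSeries (Fin (m + 1)) k)) (fun _ => 1) c' i').f *
            ∏ l ∈ (δ.transform (fun j => (X j : MvPowerSeries (Fin (m + 1)) k)) (fun _ => 1) c' i').O, X l)) →
      (∀ v, CobordantChart.initEval (fun _ : Fin (m + 1) => 1) (v + u₂)
          (δ.transform (fun j => (X j : MvPowerSeries (Fin (m + 1)) k)) (fun _ => 1) c' i').c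
          ((δ.transform (fun j => (X j : MvPowerSeries (Fin (m + 1)) k)) (fun _ => 1) c' i').f *
            ∏ l ∈ (δ.transform (fun j => (X j : MvPowerSeries (Fin (m + 1)) k)) (fun _ => 1) c' i').O, X l) =
        CobordantChart.initEval (fun _ : Fin (m + 1) => 1) v
          (δ.transform (fun j => (X j : MvPowerSeries (Fin (m + 1)) k)) (fun _ => 1) c' i').c
          ((δ.transform (fun j => (X j : MvPowerSeries (Fin (m + 1)) k)) (fun _ => 1) c' i').f *
            ∏ l ∈ (δ.transform (fun j => (X j : MvPowerSeries (Fin (m + 1)) k)) (fun _ => 1) c' i').O, X l)) →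
      (∀ v, CobordantChart.initEval (fun _ : Fin (m + 1) => 1) (v + u₃)
          (δ.transform (fun j => (X j : MvPowerSeries (Fin (m + 1)) k)) (fun _ => 1) c' i').c
          ((δ.transform (fun j => (X j : MvPowerSeries (Fin (m + 1)) k)) (fun _ => 1) c' i').f *
            ∏ l ∈ (δ.transform (fun j => (X j : MvPowerSeries (Fin (m + 1)) k)) (fun _ => 1) c' i').O, X l) =
        CobordantChart.initEval (fun _ : Fin (m + 1) => 1) v
          (δ.transform (fun j => (X j : MvPowerSeries (Fin (m + 1)) k)) (fun _ => 1) c' i').c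
          ((δ.transform (fun j => (X j : MvPowerSeries (Fin (m + 1)) k)) (fun _ => 1) c' i').f *
            ∏ l ∈ (δ.transform (fun j => (X j : MvPowerSeries (Fin (m + 1)) k)) (fun _ => 1) c' i').O, X l)) →
      ∃ α β γ : k, (α ≠ 0 ∨ β ≠ 0 ∨ γ ≠ 0) ∧ α • u₁ + β • u₂ + γ • u₃ = 0 := by
  set δ' := δ.transform (fun j => (X j : MvPowerSeries (Fin (m + 1)) k)) (fun _ => 1) c' i' with hδ'
  have hf : δ.f ≠ 0 := hadm.2.1.ne_zero
  have hpermX := isBPermissible_point_X δ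
  have hord : δ.f.order = (δ.o : ℕ∞) := GraphCurve.order_f_eq_o hadm
  have hord' : δ'.f.order = (δ'.o : ℕ∞) := GraphCurve.order_f_eq_o hadm'
  have hX : subst (fun j => (X j : MvPowerSeries (Fin (m + 1)) k)) δ.f = δ.f := congrFun subst_self _
  have heq : δ'.o = δ.o := GraphCurve.o_transform_eq_of_head_eq hhead
  have hcard : δ'.O.card = δ.O.card := GraphCurve.card_O_transform_eq_of_head_eq hhead
  -- `htwo` for `g` in the `O`-relative form for `f`
  have htwoO : ∀ u₁ u₂ u₃ : Fin (m + 1) → k,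
      (∀ v, CobordantChart.initEval (fun _ : Fin (m + 1) => 1) (v + u₁) δ.o (subst (fun j => (X j : MvPowerSeries (Fin (m + 1)) k)) δ.f) =
        CobordantChart.initEval (fun _ : Fin (m + 1) => 1) v δ.o (subst (fun j => (X j : MvPowerSeries (Fin (m + 1)) k)) δ.f)) →
      (∀ l ∈ δ.O, u₁ (strIdx (fun j => (X j : MvPowerSeries (Fin (m + 1)) k)) l) = 0) →
      (∀ v, CobordantChart.initEval (fun _ : Fin (m + 1) => 1) (v + u₂) δ.o (subst (fun j => (X j : MvPowerSeries (Fin (m + 1)) k)) δ.f) =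
        CobordantChart.initEval (fun _ : Fin (m + 1) => 1) v δ.o (subst (fun j => (X j : MvPowerSeries (Fin (m + 1)) k)) δ.f)) →
      (∀ l ∈ δ.O, u₂ (strIdx (fun j => (X j : MvPowerSeries (Fin (m + 1)) k)) l) = 0) →
      (∀ v, CobordantChart.initEval (fun _ : Fin (m + 1) => 1) (v + u₃) δ.o (subst (fun j => (X j : MvPowerSeries (Fin (m + 1)) k)) δ.f) =
        CobordantChart.initEval (fun _ : Fin (m + 1) => 1) v δ.o (subst (fun j => (X j : MvPowerSeries (Fin (m + 1)) k)) δ.f)) →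
      (∀ l ∈ δ.O, u₃ (strIdx (fun j => (X j : MvPowerSeries (Fin (m + 1)) k)) l) = 0) →
      ∃ α β γ : k, (α ≠ 0 ∨ β ≠ 0 ∨ γ ≠ 0) ∧ α • u₁ + β • u₂ + γ • u₃ = 0 := by
    intro u₁ u₂ u₃ h₁ h₁O h₂ h₂O h₃ h₃O
    rw [hX] at h₁ h₂ h₃
    simp_rw [TOT2E1.strIdx_X] at h₁O h₂O h₃O
    exact htwo u₁ u₂ u₃ ((TOT2Near.inv_mul_prod_X_iff hord δ.O u₁).mpr ⟨h₁, h₁O⟩) ((TOT2Near.inv_mul_prod_X_iff hord δ.O u₂).mpr ⟨h₂, h₂O⟩)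
      ((TOT2Near.inv_mul_prod_X_iff hord δ.O u₃).mpr ⟨h₃, h₃O⟩)
  intro w₁ w₂ w₃ hw₁ hw₂ hw₃
  have hw₁' := (TOT2Near.inv_mul_prod_X_iff hord' δ'.O w₁).mp hw₁
  have hw₂' := (TOT2Near.inv_mul_prod_X_iff hord' δ'.O w₂).mp hw₂
  have hw₃' := (TOT2Near.inv_mul_prod_X_iff hord' δ'.O w₃).mp hw₃
  exact TOT2Near.Decoration.apexPlaneO_transform_point hpermX hf hci' htwoO heq hcard w₁ w₂ w₃ hw₁'.1 hw₁'.2 hw₂'.1 hw₂'.2 hw₃'.1 hw₃'.2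

end TameFourTupleDrop

end Summit.ResolutionOfSingularities.ResolutionOfSingularities.Theorems

end
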